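import Mathlib
import Literature.NumberTheory.EllipticCurves.Smith2016.CongruentNumberGenusDeterminantRowSixBlocks
import Literature.NumberTheory.EllipticCurves.Smith2016.CongruentNumberGenusSumSelmerEightFive

/-!
# Smith 2016, Theorem 2.2 row 6 for every `k`: `Σ₂'(n) = |M₂ bordered by (y; y)|`, and `Σ₂'(n)` odd `⟹ #Sel₂(E⁽ⁿ⁾) = 8` (`n ≡ 6 (8)`)

A. Smith, *The congruent numbers have positive natural density*, arXiv:1603.08479 [Smith2016CongruentDensity],
Table 2 row 6 (source `cnc.tex` l. 100–107): for `n ≡ 6 (mod 8)` with odd part `p₁⋯p_r`,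
`ℒ₆(n) = Σ_{d₀d₁ | n, d₀ ≡ 7n (16), d₁ ≡ 7 (8)} g(d₀)g(d₁)ℒ(n/d₀d₁) + Σ_{d | n, d ≡ n (16)} g(d)ℒ(n/d)` and
`M₆ = [[A + Aᵀ + D_{y+z}, Aᵀ, y],[A, D_z, y],[yᵀ, yᵀ, 0]]` (`(2r+1) × (2r+1)`); Thm. 2.2: `ℒ₆(n) = det M₆`.
By Thm. 2.1 of the source (= [TianYuanZhang2017] Thm. 1.2 as printed), `ℒ₆(n)` is Tian–Yuan–Zhang's second
genus sum `Σ₂'(n) = Σ_{n = d₀⋯d_ℓ, d₀ ≡ 5,6,7, d₁ ≡ 1,2,3, dᵢ ≡ 1 (i>1)} ∏ g(dᵢ)`: for `n ≡ 6 (8)` the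
qualifying decompositions have main block `d₀ = d ≡ 6 ≡ n (mod 16)` (all other blocks `≡ 1 (8)`) or
`d₀ = d₁ ≡ 7 (8)` with the even block `≡ 2 (8)` (`CongruentNumberGenusSumSixDecompositions`).

What is proved (every number of prime factors; no named fact):
* `genusSum₂'_two_mul_eq_border_adjugate_six` — **row 6**: for `n = 2p₁⋯p_k` with distinct odd `pᵢ` and
  `∏ pᵢ ≡ 3 (mod 4)`, `Σ₂'(n) ≡ bᵀ adj(M₂) b (mod 2)`, `b = (t; t)`, `t = ((−1/pᵢ)₊)`,
  `M₂ = [[A + Aᵀ + D_t + D_z, Aᵀ],[A, D_z]]` — the bordered determinant `det [[M₂, b],[bᵀ, 0]] = bᵀ adj(M₂) b`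
  over `𝔽₂`.  Proof (replacing the source's closure expansions): `E = [[I,I],[0,I]]` takes `M₂` to the
  doubled forest matrix `N₂` with marks `t` and `b` to `(0; t)`, so `det M₆ = Σ_j t_j adj(N₂)_{(inr j)(inr j)}`
  (`RowSixForest`); the root-copy cofactors are rooted pointed forest sums; the dictionary and Smith's lemma
  `det P[T] = g(2d_T)` evaluate them (`RowSixBlocks`); the genus side is regrouped through the tree's brackets
  `B₆`, `B₇` of Tian–Yuan–Zhang's proof of Thm. 3.5 (`GenusSumSixDecompositions`).
* `card_selmerGroup_two_eq_eight_of_odd_genusSum₂'_six` — **for `n = 2p₁⋯p_k ≡ 6 (mod 8)` with `Σ₂'(n)` odd,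
  `#Sel⁽²⁾(E⁽ⁿ⁾/ℚ) = 8`** (Smith's Prop. 3.2, "`ℒ_x(n)` can only be nonzero if `Sel⁽²⁾(E⁽ⁿ⁾)` has rank exactly
  three", here for `x = 6`: a nonzero root-copy cofactor of `N₂ = M·[[0,I],[I,0]]` (`M` Monsky's even matrix)
  forces `rank M ≥ 2k − 1`, so Monsky's `s(n) ≤ 1`, and `s(n)` is odd for `n ≡ 6 (8)`), with the
  enumeration-free form `…_six'` for every square-free `N ≡ 6 (mod 8)`.  By Tian–Yuan–Zhang's Theorem 1.2 (not
  used here) the same hypothesis gives analytic rank one; this is its `2`-Selmer companion, with no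
  `L`-function.
-/

namespace Literature.NumberTheory.EllipticCurves.Smith2016

open _root_.Matrix Finset Literature.LinearAlgebra.Matrix Literature.Combinatorics.Enumerative
open Literature.NumberTheory.EllipticCurves.HeathBrown1994
open Literature.NumberTheory.EllipticCurves.TianYuanZhang2017
open Literature.NumberTheory.EllipticCurves.MonskySelmerParity

variable {k : ℕ} (p : Fin k → ℕ)

section RowSix

/-- **Smith 2016, Theorem 2.2 row 6 — for every `k`**: for `n = 2p₁⋯p_k` with distinct odd primes `pᵢ` and
`∏ pᵢ ≡ 3 (mod 4)` (`n ≡ 6 (mod 8)`), Tian–Yuan–Zhang's second genus sum satisfies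
`Σ₂'(n) = ℒ₆(n) ≡ bᵀ adj(M₂) b (mod 2)` with `b = ((−1/pᵢ)₊; (−1/pᵢ)₊)` and
`M₂ = [[A + Aᵀ + D_t + D_z, Aᵀ],[A, D_z]]` — the determinant of Smith's bordered matrix `M₆ = [[M₂, b],[bᵀ, 0]]`.
[cite: Smith2016CongruentDensity, Thm. 2.2 row 6 / Table 2 (source cnc.tex l. 100–107) and §2.2 (cnc2.tex l. 73–110)] [cite: TianYuanZhang2017, Thm. 1.2 as printed (Σ₂' for n ≡ 6 (8))] -/
theorem genusSum₂'_two_mul_eq_border_adjugate_six (hp : ∀ i, (p i).Prime) (hodd : ∀ i, Odd (p i))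
    (hinj : Function.Injective p) (h4 : (∏ i, p i) % 4 = 3) :
    ((genusSum₂' (2 * ∏ i, p i) (fun d => genusClassNumber (GenusField d)) : ℕ) : ZMod 2) =
      Sum.elim (fun i => addLegendreSym (-1) (p i)) (fun i => addLegendreSym (-1) (p i)) ⬝ᵥ
        ((fromBlocks (legendreMatrix p + (legendreMatrix p)ᵀ + (legendreDiagonal p (-1) + legendreDiagonal p 2))
            (legendreMatrix p)ᵀ (legendreMatrix p) (legendreDiagonal p 2)).adjugate *ᵥ
          Sum.elim (fun i => addLegendreSym (-1) (p i)) (fun i => addLegendreSym (-1) (p i))) := by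
  rw [natCast_genusSum₂'_two_mul_eq_six p hp hodd hinj h4, border_adjugate_six_eq_sum_genusWeight p hp hodd hinj h4]

end RowSix

section SelmerEight

/-- **Monsky's even matrix and the doubled forest matrix have the same rank**: `M · [[0, I],[I, 0]] = N₂`.
[cite: HeathBrown1994SelmerCongruentII, Appendix (Monsky), typescript p. 41 L20–L36 (the even matrix)] -/
theorem rank_monskyMatrixEven_eq_rank_bigN :
    (monskyMatrixEven p).rank =
      (bigN (fun i j => legendreMatrix p i j) univ (fun i => addLegendreSym (-1) (p i))
        (fun i => addLegendreSym 2 (p i)) (fun i => addLegendreSym 2 (p i))).rank := by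
  rw [← monskyMatrixEven_mul_swap p, Matrix.rank_mul_eq_left_of_isUnit_det]
  rw [det_fromBlocks_swap]
  exact isUnit_one

/-- **`Σ₂'(n)` odd `⟹ #Sel⁽²⁾(E⁽ⁿ⁾/ℚ) = 8` for `n = 2p₁⋯p_k ≡ 6 (mod 8)`** (every `k`): the bordered form
`(t;t)ᵀ adj(M₂) (t;t) = Σ_j t_j adj(N₂)_{(inr j)(inr j)} = Σ₂'(n)` is `1`, so some cofactor of `N₂` is nonzero,
`rank M = rank N₂ ≥ 2k − 1` for Monsky's even matrix `M`, Monsky's `s(n) = 2k − rank M ≤ 1`; `s(n)` is odd for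
`n ≡ 6 (8)`, so `s(n) = 1` and `#Sel₂ = 2^{2+1}`.
[cite: Smith2016CongruentDensity, Prop. 3.2 (chunk p0011 L58–L66: "ℒ_x(n) can only be nonzero if Sel⁽²⁾(E⁽ⁿ⁾) has rank exactly three") with Thm. 2.2 row 6] [cite: HeathBrown1994SelmerCongruentII, Appendix (Monsky), Theorem (typescript p. 38 L5–L7) and p. 41 L20–L36] -/
theorem card_selmerGroup_two_eq_eight_of_odd_genusSum₂'_six (hp : ∀ i, (p i).Prime)
    (hodd : ∀ i, Odd (p i)) (hinj : Function.Injective p) (h4 : (∏ i, p i) % 4 = 3)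
    (hodd2 : Odd (genusSum₂' (2 * ∏ i, p i) fun d => genusClassNumber (GenusField d))) :
    Nat.card ((congruentNumberCurve (2 * ∏ i, p i)).selmerGroup 2) = 8 := by
  have hp2 := ne_two_of_odd p hodd
  set N₂ := bigN (fun i j => legendreMatrix p i j) univ (fun i => addLegendreSym (-1) (p i))
    (fun i => addLegendreSym 2 (p i)) (fun i => addLegendreSym 2 (p i)) with hN₂
  have hq : ∑ j, addLegendreSym (-1) (p j) * N₂.adjugate (Sum.inr j) (Sum.inr j) = 1 := by
    rw [hN₂, ← border_adjugate_six_eq_sum_adjugate_inr p,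
      ← genusSum₂'_two_mul_eq_border_adjugate_six p hp hodd hinj h4]
    exact (ZMod.natCast_eq_one_iff_odd).mpr hodd2
  have hex : ∃ j, N₂.adjugate (Sum.inr j) (Sum.inr j) ≠ 0 := by
    by_contra hall
    push Not at hall
    rw [Fintype.sum_congr _ (fun _ => (0 : ZMod 2)) (fun j => by rw [hall j, mul_zero]), sum_const_zero] at hq
    exact zero_ne_one hq
  obtain ⟨j, hj⟩ := hex
  have hrank := card_le_rank_add_one_of_adjugate_ne_zero N₂ hj
  rw [Fintype.card_sum, Fintype.card_fin, hN₂, ← rank_monskyMatrixEven_eq_rank_bigN p] at hrank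
  have hsodd : Odd (monskySelmerRankEven p) :=
    (odd_monskySelmerRankEven_iff p hp hp2 hinj).mpr (by omega)
  have hs1 : monskySelmerRankEven p = 1 := by
    have hle : monskySelmerRankEven p ≤ 1 := by rw [monskySelmerRankEven]; omega
    rcases Nat.le_one_iff_eq_zero_or_eq_one.mp hle with h0 | h1
    · rw [h0] at hsodd; exact absurd hsodd (by decide)
    · exact h1
  rw [monsky_card_selmerGroup_two_even_holds k p hp hodd hinj, hs1]
  norm_num

/-- **For every square-free `N ≡ 6 (mod 8)`: `Σ₂'(N)` odd `⟹ #Sel⁽²⁾(E_N/ℚ) = 8`** (enumeration-free).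
[cite: Smith2016CongruentDensity, Prop. 3.2 with Thm. 2.2 row 6] [cite: TianYuanZhang2017, Thm. 1.2 as printed (the sum Σ₂' for n ≡ 6 (8))] -/
theorem card_selmerGroup_two_eq_eight_of_odd_genusSum₂'_six' {N : ℕ} (hN : Squarefree N) (h8 : N % 8 = 6)
    (hodd2 : Odd (genusSum₂' N fun d => genusClassNumber (GenusField d))) :
    Nat.card ((congruentNumberCurve N).selmerGroup 2) = 8 := by
  obtain ⟨k, p, hp, hp2, hinj, hprod⟩ :=
    exists_odd_prime_family_of_squarefree_even hN (Nat.even_iff.mpr (by omega))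
  have hodd : ∀ i, Odd (p i) := fun i => (hp i).odd_of_ne_two (hp2 i)
  subst hprod
  exact card_selmerGroup_two_eq_eight_of_odd_genusSum₂'_six p hp hodd hinj (by omega) hodd2

end SelmerEight

end Literature.NumberTheory.EllipticCurves.Smith2016
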